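import Summits.ResolutionOfSingularities.ResolutionOfSingularities.Theorems.WeightedInvariantIota3Eps
import Literature.AlgebraicGeometry.Resolution.RegularLocalRingsProofs
import HarnessLib

/-!
# The P3 letter `ε` on a chart: «`ε = 0` ⟺ the reduced top-`ν` stratum is regular at the point» — ring side of
# clause (c8ε) — door `HypersurfaceCentreConstruction` (stmt-ResolutionOfSingularities-19897), route `WeightedInvariant`,
# rung P3, ORDER (o32-ι-a‴)

[OURS · L1 W4.3 · cell `res-hironaka`, HUMAN RULING D-0089] Helper file `--supports stmt-ResolutionOfSingularities-19897`
(res-type-047 on res-L1-w43-plan-1's OFFER (o32-ι-a‴), IOTA3-DESIGN v1 §2.2 «(c8ε|ν) — the one real cost: inside the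
stratum `{ν = α}` the set `{ε = 1}` is the NON-REGULAR LOCUS of the reduced closed subscheme `Σ_α`»).  This file is the
commutative algebra of that sentence; the scheme-side closedness statement is the sequel
`…WeightedInvariantIota3EpsUpperSemicontinuous`.  CANDIDATE DESIGN OBJECTS ONLY (`iotaEps` is res-type-013's typed letter,
p527087): nothing here is a statement of the manuscript under review (Hironaka 2017, [claim: Hironaka2017, status:
under-review]); nothing is attributed to its author; nothing here claims anything about resolution of singularities.
AI work, weaker than expert review.

## What is proved (def-free)

Throughout `A` is a commutative ring, `𝔭` a prime, `S` ANY localization of `A` at `𝔭` (e.g. the stalk `𝒪_{Y,y}` of an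
affine chart `Spec A ⊇ U ∋ y`), `a ∈ A` (the chart equation), `J ⊆ A` an ideal (the radical ideal of the closed
super-level set `{ν ≥ α}` on the chart).

* §1 `algebraMapSubmonoid_quotient_primeCompl_eq`, `isLocalization_atPrime_quotient_map`,
  `isRegularLocalRing_quotient_map_iff` — localization commutes with quotients: for `J ≤ q`, `S ⧸ J·S` (with `S = A_q`)
  is the localization of `A ⧸ J` at `q ⧸ J`, so `S ⧸ J·S` is a regular local ring iff `q ⧸ J ∈ Reg(A ⧸ J)`.
* §2 `iotaOrd_algebraMap_eq`, `iotaOrd_localization_atPrime_algebraMap_eq`, `comap_le_of_isLocalization_atPrime` — the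
  order function read on `S` and on `S_𝔮` is the order function read on `A_𝔭` and on `A_{𝔮 ∩ A}` ((c6) iso-invariance of
  `iotaOrd`, res-type-073 p502169).
* §2 `topStratum_iotaOrd_eq_setOf_map_le` — if, among the primes `q ≤ 𝔭`, `J ≤ q` holds EXACTLY when `a` keeps at `A_q`
  its order at `A_𝔭` (on a smooth chart: the points of `{ν ≥ α} = V(J)` specialising to a point `y` of the stratum
  `{ν = α}` are exactly the generisations of `y` of the same order, by (c7)), then the equimultiple locus
  `ContactCylinder.topStratum iotaOrd S (a/1)` is `V(J·S) ⊆ Spec S`.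
* §2 **`isPermissibleEquimultipleLocus_iff_isRegularLocalRing_quotient`** — under the same hypothesis and `J` radical:
  `Iota3.IsPermissibleEquimultipleLocus S (a/1) ↔ IsRegularLocalRing (S ⧸ J·S)`, i.e. **`ε(S, a) = 0` iff the local
  ring `S ⧸ J·S` of the REDUCED stratum is regular** (`J·S` is radical; a regular local ring is a domain —
  `isDomain_of_isRegularLocalRing`, Matsumura 14.3 — so the single prime `P` of the definition is forced to be `J·S`);
  `iotaEps_eq_zero_iff_isRegularLocalRing_quotient`, `iotaEps_eq_one_iff_not_isRegularLocalRing_quotient`.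

## References

* res-L1-w43-plan-1, `L/res-L1-w43-plan-1/IOTA3-DESIGN.md` v1 §2.2 (OURS, AI planning); res-type-078 `IOTA3-INPUT.md` v1.1.
* H. Matsumura, *Commutative Ring Theory*, CUP 1986, Thm. 14.3 (regular local rings are domains). [Matsumura1987]
-/

noncomputable section

set_option linter.dupNamespace false -- mandated namespace `Summit.<Summit>.<Problem>` of this single-conjunct summit

open IsLocalRing
open Literature.AlgebraicGeometry.Resolution
open Summit.ResolutionOfSingularities.ResolutionOfSingularities.Theorems (ContactCylinder.topStratum)
open Summit.ResolutionOfSingularities.ResolutionOfSingularities.Theorems.ContactCylinder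

namespace Summit.ResolutionOfSingularities.ResolutionOfSingularities.Cruxes.HypersurfaceCentreConstruction.LocalEngine

namespace Iota3

/-! ## §1 Localization commutes with quotients: `A_q ⧸ J A_q = (A ⧸ J)_{q ⧸ J}` -/

section LocQuot

variable {A : Type} [CommRing A] (J q : Ideal A) [q.IsPrime]

/-- For `J ≤ q` prime, `q ⧸ J` is a prime of `A ⧸ J`. [folklore] -/
theorem isPrime_map_quotient_mk (hJq : J ≤ q) : (q.map (Ideal.Quotient.mk J)).IsPrime :=
  Ideal.map_isPrime_of_surjective Ideal.Quotient.mk_surjective (by rwa [Ideal.mk_ker])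

/-- For `J ≤ q`, the image in `A ⧸ J` of the complement of `q` is the complement of `q ⧸ J`. [folklore] -/
theorem algebraMapSubmonoid_quotient_primeCompl_eq (hJq : J ≤ q) [(q.map (Ideal.Quotient.mk J)).IsPrime] :
    Algebra.algebraMapSubmonoid (A ⧸ J) q.primeCompl = (q.map (Ideal.Quotient.mk J)).primeCompl := by
  ext x
  obtain ⟨x, rfl⟩ := Ideal.Quotient.mk_surjective x
  have hmem : Ideal.Quotient.mk J x ∈ q.map (Ideal.Quotient.mk J) ↔ x ∈ q := by
    rw [Ideal.mem_quotient_iff_mem_sup, sup_eq_left.mpr hJq]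
  simp only [Algebra.algebraMapSubmonoid, Submonoid.mem_map, Ideal.mem_primeCompl_iff,
    Ideal.Quotient.algebraMap_eq, hmem]
  constructor
  · rintro ⟨m, hm, hmx⟩ hx
    apply hm
    have h : m - x ∈ J := Ideal.Quotient.eq.mp hmx
    have := q.add_mem (hJq h) hx
    rwa [sub_add_cancel] at this
  · intro hx
    exact ⟨x, hx, rfl⟩

variable (S : Type) [CommRing S] [Algebra A S] [IsLocalization.AtPrime S q]

/-- **Localization commutes with quotients**: for `S` a localization of `A` at the prime `q ⊇ J`, `S ⧸ J·S` is a
localization of `A ⧸ J` at `q ⧸ J`. [folklore] -/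
theorem isLocalization_atPrime_quotient_map (hJq : J ≤ q) [(q.map (Ideal.Quotient.mk J)).IsPrime] :
    IsLocalization.AtPrime (S ⧸ J.map (algebraMap A S)) (q.map (Ideal.Quotient.mk J)) := by
  have h : IsLocalization (Algebra.algebraMapSubmonoid (A ⧸ J) q.primeCompl) (S ⧸ J.map (algebraMap A S)) :=
    inferInstance
  rwa [algebraMapSubmonoid_quotient_primeCompl_eq J q hJq] at h

/-- **`S ⧸ J·S` is a regular local ring iff `(A ⧸ J)_{q ⧸ J}` is** (`S` a localization of `A` at `q ⊇ J`). [folklore] -/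
theorem isRegularLocalRing_quotient_map_iff (hJq : J ≤ q) [(q.map (Ideal.Quotient.mk J)).IsPrime] :
    IsRegularLocalRing (S ⧸ J.map (algebraMap A S)) ↔
      IsRegularLocalRing (Localization.AtPrime (q.map (Ideal.Quotient.mk J))) := by
  haveI := isLocalization_atPrime_quotient_map J q S hJq
  let e : Localization.AtPrime (q.map (Ideal.Quotient.mk J)) ≃ₐ[A ⧸ J] S ⧸ J.map (algebraMap A S) :=
    IsLocalization.algEquiv (q.map (Ideal.Quotient.mk J)).primeCompl _ _
  exact ⟨fun h => IsRegularLocalRing.of_ringEquiv e.toRingEquiv.symm,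
    fun h => IsRegularLocalRing.of_ringEquiv e.toRingEquiv⟩

end LocQuot

/-! ## §2 The equimultiple locus of a localized position `(S, a/1)`, `S = A_𝔭` -/

section Chart

variable {A : Type} [CommRing A]

/-- The order function on `S` is the order function on `A_𝔭` ((c6) iso-invariance). [OURS] -/
theorem iotaOrd_algebraMap_eq (𝔭 : Ideal A) [𝔭.IsPrime] (S : Type) [CommRing S] [Algebra A S]
    [IsLocalization.AtPrime S 𝔭] (a : A) :
    iotaOrd S (algebraMap A S a) =
      iotaOrd (Localization.AtPrime 𝔭) (algebraMap A (Localization.AtPrime 𝔭) a) := by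
  let e : Localization.AtPrime 𝔭 ≃ₐ[A] S := IsLocalization.algEquiv 𝔭.primeCompl _ _
  have he : e (algebraMap A (Localization.AtPrime 𝔭) a) = algebraMap A S a := e.commutes a
  have h6 : iotaOrd S (e (algebraMap A (Localization.AtPrime 𝔭) a)) =
      iotaOrd (Localization.AtPrime 𝔭) (algebraMap A (Localization.AtPrime 𝔭) a) :=
    iotaOrd_isoInvariant _ _ e.toRingEquiv _
  rw [← he, h6]

/-- A prime of the localization `S` contracts to a prime `≤ 𝔭`. [folklore] -/
theorem comap_le_of_isLocalization_atPrime (𝔭 : Ideal A) [𝔭.IsPrime] (S : Type) [CommRing S] [Algebra A S]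
    [IsLocalization.AtPrime S 𝔭] (𝔮 : Ideal S) [𝔮.IsPrime] : 𝔮.comap (algebraMap A S) ≤ 𝔭 := by
  intro x hx
  by_contra hx𝔭
  have hu : IsUnit (algebraMap A S x) := IsLocalization.map_units S (⟨x, hx𝔭⟩ : 𝔭.primeCompl)
  exact (Ideal.IsPrime.ne_top ‹𝔮.IsPrime›) (Ideal.eq_top_of_isUnit_mem _ (Ideal.mem_comap.mp hx) hu)

/-- The order function on `S_𝔮` is the order function on `A_{𝔮 ∩ A}` ((c6) along the canonical isomorphism
`A_{𝔮 ∩ A} ≃ S_𝔮`). [OURS] -/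
theorem iotaOrd_localization_atPrime_algebraMap_eq (𝔭 : Ideal A) [𝔭.IsPrime] (S : Type) [CommRing S]
    [Algebra A S] [IsLocalization.AtPrime S 𝔭] (a : A) (𝔮 : Ideal S) [𝔮.IsPrime] :
    iotaOrd (Localization.AtPrime 𝔮) (algebraMap S (Localization.AtPrime 𝔮) (algebraMap A S a)) =
      iotaOrd (Localization.AtPrime (𝔮.comap (algebraMap A S)))
        (algebraMap A (Localization.AtPrime (𝔮.comap (algebraMap A S))) a) := by
  haveI : IsLocalization (𝔮.comap (algebraMap A S)).primeCompl (Localization.AtPrime 𝔮) :=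
    IsLocalization.isLocalization_isLocalization_atPrime_isLocalization 𝔭.primeCompl
      (Localization.AtPrime 𝔮) 𝔮
  let e : Localization.AtPrime (𝔮.comap (algebraMap A S)) ≃ₐ[A] Localization.AtPrime 𝔮 :=
    IsLocalization.algEquiv (𝔮.comap (algebraMap A S)).primeCompl _ _
  have he : e (algebraMap A (Localization.AtPrime (𝔮.comap (algebraMap A S))) a) =
      algebraMap A (Localization.AtPrime 𝔮) a := e.commutes a
  have h6 : iotaOrd (Localization.AtPrime 𝔮) (e (algebraMap A (Localization.AtPrime (𝔮.comap (algebraMap A S))) a)) =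
      iotaOrd (Localization.AtPrime (𝔮.comap (algebraMap A S)))
        (algebraMap A (Localization.AtPrime (𝔮.comap (algebraMap A S))) a) :=
    iotaOrd_isoInvariant _ _ e.toRingEquiv _
  rw [← IsScalarTower.algebraMap_apply A S (Localization.AtPrime 𝔮), ← he, h6]

/-- **The equimultiple locus on a chart.**  If, among the primes `q ≤ 𝔭` of `A`, `J ≤ q` holds exactly when `a` has at
`A_q` the order it has at `A_𝔭`, then `Σ(S, a/1) = V(J·S)`. [OURS] -/
theorem topStratum_iotaOrd_eq_setOf_map_le (𝔭 : Ideal A) [𝔭.IsPrime] (S : Type) [CommRing S] [Algebra A S]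
    [IsLocalization.AtPrime S 𝔭] (a : A) (J : Ideal A)
    (hJ : ∀ (q : Ideal A) [q.IsPrime], q ≤ 𝔭 →
      (J ≤ q ↔ iotaOrd (Localization.AtPrime q) (algebraMap A (Localization.AtPrime q) a) =
        iotaOrd (Localization.AtPrime 𝔭) (algebraMap A (Localization.AtPrime 𝔭) a))) :
    topStratum iotaOrd S (algebraMap A S a) = {𝔮 | J.map (algebraMap A S) ≤ 𝔮.asIdeal} := by
  ext 𝔮
  rw [Theorems.ContactCylinder.mem_topStratum_iff, Set.mem_setOf_eq,
    iotaOrd_localization_atPrime_algebraMap_eq 𝔭 S a 𝔮.asIdeal,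
    iotaOrd_algebraMap_eq 𝔭 S a,
    ← hJ (𝔮.asIdeal.comap (algebraMap A S)) (comap_le_of_isLocalization_atPrime 𝔭 S 𝔮.asIdeal),
    Ideal.map_le_iff_le_comap]

/-- The extension to a localization of a radical ideal is radical. [folklore] -/
theorem isRadical_map_of_isRadical (𝔭 : Ideal A) [𝔭.IsPrime] (S : Type) [CommRing S] [Algebra A S]
    [IsLocalization.AtPrime S 𝔭] {J : Ideal A} (hJrad : J.IsRadical) : (J.map (algebraMap A S)).IsRadical := by
  rw [← Ideal.radical_eq_iff, ← IsLocalization.map_radical 𝔭.primeCompl S J, hJrad.radical]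

/-- **`ε = 0` ⟺ the reduced stratum is regular at the point (ring form).**  Under the hypothesis of
`topStratum_iotaOrd_eq_setOf_map_le` and with `J` radical:
`IsPermissibleEquimultipleLocus S (a/1) ↔ IsRegularLocalRing (S ⧸ J·S)`.  (⇐: a regular local ring is a domain, so
`J·S` is the prime `P` of the definition; ⇒: `V(P) = V(J·S)` with both ideals radical forces `P = J·S`.) [OURS] -/
theorem isPermissibleEquimultipleLocus_iff_isRegularLocalRing_quotient (𝔭 : Ideal A) [𝔭.IsPrime] (S : Type) [CommRing S]
    [Algebra A S] [IsLocalization.AtPrime S 𝔭] (a : A) (J : Ideal A) (hJrad : J.IsRadical)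
    (hJ : ∀ (q : Ideal A) [q.IsPrime], q ≤ 𝔭 →
      (J ≤ q ↔ iotaOrd (Localization.AtPrime q) (algebraMap A (Localization.AtPrime q) a) =
        iotaOrd (Localization.AtPrime 𝔭) (algebraMap A (Localization.AtPrime 𝔭) a))) :
    IsPermissibleEquimultipleLocus S (algebraMap A S a) ↔
      IsRegularLocalRing (S ⧸ J.map (algebraMap A S)) := by
  have hV := topStratum_iotaOrd_eq_setOf_map_le 𝔭 S a J hJ
  have hrad : (J.map (algebraMap A S)).IsRadical := isRadical_map_of_isRadical 𝔭 S hJrad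
  constructor
  · rintro ⟨P, hP, hreg, hSP⟩
    have h1 : ∀ 𝔮 : PrimeSpectrum S, P ≤ 𝔮.asIdeal ↔ J.map (algebraMap A S) ≤ 𝔮.asIdeal := fun 𝔮 => by
      have h := Set.ext_iff.mp (hSP.symm.trans hV) 𝔮
      simpa only [Set.mem_setOf_eq] using h
    have hPJ : J.map (algebraMap A S) = P := by
      refine le_antisymm ((h1 ⟨P, hP⟩).mp le_rfl) ?_
      rw [← hrad.radical, Ideal.radical_eq_sInf]
      exact le_sInf fun I hI => (h1 ⟨I, hI.2⟩).mpr hI.1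
    rw [hPJ]
    exact hreg
  · intro hreg
    haveI := hreg
    haveI : IsDomain (S ⧸ J.map (algebraMap A S)) := isDomain_of_isRegularLocalRing _
    have hprime : (J.map (algebraMap A S)).IsPrime := (Ideal.Quotient.isDomain_iff_prime _).mp inferInstance
    exact ⟨J.map (algebraMap A S), hprime, hreg, hV⟩

/-- `ε(S, a/1) = 0` iff `S ⧸ J·S` is a regular local ring (same hypotheses). [OURS] -/
theorem iotaEps_eq_zero_iff_isRegularLocalRing_quotient (𝔭 : Ideal A) [𝔭.IsPrime] (S : Type) [CommRing S]
    [Algebra A S] [IsLocalization.AtPrime S 𝔭] (a : A) (J : Ideal A) (hJrad : J.IsRadical)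
    (hJ : ∀ (q : Ideal A) [q.IsPrime], q ≤ 𝔭 →
      (J ≤ q ↔ iotaOrd (Localization.AtPrime q) (algebraMap A (Localization.AtPrime q) a) =
        iotaOrd (Localization.AtPrime 𝔭) (algebraMap A (Localization.AtPrime 𝔭) a))) :
    iotaEps S (algebraMap A S a) = 0 ↔ IsRegularLocalRing (S ⧸ J.map (algebraMap A S)) := by
  rw [iotaEps_eq_zero_iff, isPermissibleEquimultipleLocus_iff_isRegularLocalRing_quotient 𝔭 S a J hJrad hJ]

/-- `ε(S, a/1) = 1` iff `S ⧸ J·S` is NOT a regular local ring (same hypotheses). [OURS] -/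
theorem iotaEps_eq_one_iff_not_isRegularLocalRing_quotient (𝔭 : Ideal A) [𝔭.IsPrime] (S : Type) [CommRing S]
    [Algebra A S] [IsLocalization.AtPrime S 𝔭] (a : A) (J : Ideal A) (hJrad : J.IsRadical)
    (hJ : ∀ (q : Ideal A) [q.IsPrime], q ≤ 𝔭 →
      (J ≤ q ↔ iotaOrd (Localization.AtPrime q) (algebraMap A (Localization.AtPrime q) a) =
        iotaOrd (Localization.AtPrime 𝔭) (algebraMap A (Localization.AtPrime 𝔭) a))) :
    iotaEps S (algebraMap A S a) = 1 ↔ ¬ IsRegularLocalRing (S ⧸ J.map (algebraMap A S)) := by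
  rw [iotaEps_eq_one_iff, isPermissibleEquimultipleLocus_iff_isRegularLocalRing_quotient 𝔭 S a J hJrad hJ]

end Chart

end Iota3

end Summit.ResolutionOfSingularities.ResolutionOfSingularities.Cruxes.HypersurfaceCentreConstruction.LocalEngine

end
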